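import Literature.NumberTheory.LFunctions.WeilTwoPrimeDeflL2Base
import Literature.NumberTheory.LFunctions.WeilTwoPrimeDeflL2DataR
import Literature.NumberTheory.LFunctions.WeilTwoPrimeCellsT120
import Literature.NumberTheory.LFunctions.WeilTwoPrimeCertificateDeflated
import HarnessLib

/-!
# Deflated two-prime certificate L2: the certificate `weilCertDeflL2 : WeilCert23` and its augmented coefficient matrix

`weilCertDeflL2` = base `weilCertDeflL2Base` + `j = 5` + `pnu = 64` + the cells `weilTwoPrimeCellsT120` + support `b = 1733/2500` + the table `weilCertDeflL2Nu`; penalty data `weilCertDeflL2R`; `weilCertDeflL2P = P_r + Σ μ ĉ ĉᵀ`. [cite: Yoshida1992, §6, Thm 1 p. 310] Data only.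
-/

noncomputable section

namespace Literature.NumberTheory.LFunctions

/-- **The deflated two-prime certificate L2** (`a₀ = b = 1733/2500`, `N = 255`, `T = 120`, `β₂₃ = 13/20`, k_even = 5, k_odd = 5). [folklore] -/
def weilCertDeflL2 : WeilCert23 := ⟨weilCertDeflL2Base, 5, 64, weilTwoPrimeCellsT120, 1733/2500, weilCertDeflL2Nu⟩

/-- The base of `weilCertDeflL2` is `weilCertDeflL2Base` (definitional). [folklore] -/
theorem weilCertDeflL2_base : weilCertDeflL2.base = weilCertDeflL2Base := rfl

/-- The table of `weilCertDeflL2` is `weilCertDeflL2Nu` (definitional). [folklore] -/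
theorem weilCertDeflL2_nuTab : weilCertDeflL2.nuTab = weilCertDeflL2Nu := rfl

/-- The augmented coefficient matrix `P_r + Σ μ ĉ ĉᵀ` of certificate L2. [folklore] -/
def weilCertDeflL2P (k l : ℕ) : ℚ := weilCertDeflL2Base.prQ weilCertDeflL2Nu k l + rankOneQ weilCertDeflL2R k l

/-- `weilCertDeflL2P` is the augmented matrix of the certificate (definitional). [folklore] -/
theorem weilCertDeflL2P_eq : weilCertDeflL2P = fun k l ↦ weilCertDeflL2.base.prQ weilCertDeflL2.nuTab k l + rankOneQ weilCertDeflL2R k l := rfl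

end Literature.NumberTheory.LFunctions
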